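import Summits.Schanuel.Schanuel.Theorems.RootDecomp1KSubspaceBranch01

/-!
# RootDecomp1KSubspaceBranch — lens 1, generation 52, node 11 «p-ADIC SUBSPACE AT THE LIVE NEAR-ROOT BRANCH — m₀ = 2 BELOW RIDOUT'S EXPONENT» (RULE K-R40 (viii)(α)) — continuation (RootDecomp1KSubspaceBranch02): §4 algebraicity of γ_β, the integer vector and the 3 + 3 forms, §5 the exponent inequality

(lens-1 g52 node 11 HOME kernel K = HOME/decomp-schanuel-lens-1/g52/SubspaceBranch.lean a7b59aa9…, 1162 l, 79 thm + 9 def, imports tree …RootDecomp1KXTop03 + …RootDecomp1KXAll05 + …RootDecomp1KLevelFinite11 + …RootDecomp1KLevelFinite13 ONLY; Probe SubspaceBranchProbe.lean 53090850… / Ctrl0 d8674a5f… / Ctrl 041869f9…; memo NODE-g52.md 489a38e4…; SHA256SUMS; cite-kind ledger item wi-102433 (PadicSubspace → statement-only Literature fact typed to Bilu, Sém. Bourbaki 967 Thm 2.3); CLAIM L2534, crit EX-ANTE PRICE L2535 (ONE THEOREM ×1 «SUBSPACE BRANCH» under RULE K-R40 (viii)(α) iff CHECKLIST K-g52; RULE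 K-R41), NODE L2542 / REQUEST L2543, writer re-check L2548, critic VERDICT L2546: CLEARED — THEOREM ×1 «SUBSPACE BRANCH» under RULE K-R40 (viii)(α), CHECKLIST K-g52 met; PORT GO L2546/L2547 (A) (four parts, docstrings, private re-emissions, scoped maxHeartbeats, «(sources: …)» binder — sanctioned ex ante); RULES K-R41 / K-R42. Port by census-1 gen 22 as `RootDecomp1KSubspaceBranch01–04` (`--supports stmt-Schanuel-33364`; no census credit): 01 = §0 the ONE new Diophantine input typed by name **`PadicSubspace : Prop`** ([hypothesis] definition — Schlickewei's p-adic Subspace Theorem over `ℚ` at `{∞, p}`, integer points, algebraic coefficients, `ε = 1/q`; sources in the docstring; a THEOREM in print, NOT proved in the tree; NOT the tree's rational-form `Subspace*` I–VI) + §1 helpers + §2 the ultrametric Taylor tail + §3 the second-order level identity and the refined approximation `‖r − β + 2^{N!}·γ_β‖₂` at a simple root; 02 = §4 algebraicity of the correction `γ_β`, the integer vector `xvec N r = (num r, den r, 2^{N!}·den r)` and the `3 + 3` linear forms `Lform` / `Mform` (linear independence, algebraicity) + §5 the exponent inequality (`ε = 1/8`, `N₀ = N₀(C, P)`); 03 =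 §6 subspace-by-subspace finiteness of levels (no Diophantine input) + §7 ASSEMBLY **`thinFibreAt_xPoly_of_padicSubspace (hS : PadicSubspace) … (hsep) (hdeg) (hm : 2 ≤ m₀) (hme : e + 1 ≤ m₀) : ThinFibreAt m₀ (xPolyP k c)`** (the tree's `RootDecomp1KXTop.thinFibreAt_xPoly` with `3 ≤ m₀` replaced by `2 ≤ m₀`; the `m₀ ≥ 3` branch delegated to the tree by name); 04 = §8 intrinsic form + the residual of record RE-BOOKED (`SiegelShapesOffSbAt`, `ThinFibre m₀ ⟸ PadicSubspace ∧ SiegelShapesOffSbAt m₀`; bookkeeping ×0 by K-R40 (vi)) + §9 members at `m₀ = 2` (`M17P` = x²(Y²−17) + x(Y³+Y+1) + (Y³−2), `L17P` = (Y+3) + x(Y²−17), the family) and the COSTUME TEST BY NAME (`¬ DecidedAt 2 M17P` disjunct by disjunct). PORT EDITS: K's module-docstring line «Imports: tree XTop03, LevelFinite13 only» corrected to the four actual imports (writer L2548; docstring-only); 20 one-line docstrings added on undocumented computation lemmas (statements quoted); the 14 `private` helpers of K stay private (file-local copies re-emitted in later parts where used); K's five `set_option maxHeartbeats … in` kept as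 in K; statements and proofs otherwise VERBATIM. Rung 0 — nothing here proves Schanuel, 33364, 33363, 31077, ThinFibre 2 or SiegelShapesOffAt 2; the headline is CONDITIONAL on `PadicSubspace`.)
-/

noncomputable section

namespace Summit.Schanuel.Schanuel.Theorems.RootDecomp1KSubspaceBranch

open Polynomial LiouvilleNumber
open scoped Nat
open Summit.Schanuel.Schanuel.Theorems.RootDecomp1KSkelCell (SkelLiouvilleFix)
open Summit.Schanuel.Schanuel.Theorems.RootDecomp1KTwoBaseCell (psNumer partialSum_eq_psNumer_div)
open Summit.Schanuel.Schanuel.Theorems.RootDecomp1KRelLiouvilleCell (partialSum_two_strictMono)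
open Summit.Schanuel.Schanuel.Theorems.RootDecomp1KDegreeLadder
open Summit.Schanuel.Schanuel.Theorems.RootDecomp1KXLinearCore
open Summit.Schanuel.Schanuel.Theorems.RootDecomp1KXLinear
open Summit.Schanuel.Schanuel.Theorems.RootDecomp1KXLinearII
open Summit.Schanuel.Schanuel.Theorems.RootDecomp1KXTop
open Summit.Schanuel.Schanuel.Theorems.RootDecomp1KXAll
open Summit.Schanuel.Schanuel.Theorems.RootDecomp1KLevelFinite

/-! ### §4  Algebraicity of the correction; the integer vector and the `3 + 3` linear forms -/

/-- a root in `ℂ₂` of a non-zero integer polynomial is algebraic over `ℚ`. -/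
theorem isAlgebraic_of_aeval_eq_zero {B : ℤ[X]} (hB : B ≠ 0) {β : PadicAlgCl 2} (hβ : aeval β B = 0) :
    IsAlgebraic ℚ β :=
  IsAlgebraic.extendScalars (R := ℤ) (algebraMap ℤ ℚ).injective_int ⟨B, hB, hβ⟩

/-- integer-polynomial expressions in an algebraic `β` are algebraic. -/
theorem isAlgebraic_aeval_int (q : ℤ[X]) {β : PadicAlgCl 2} (hβ : IsAlgebraic ℚ β) : IsAlgebraic ℚ (aeval β q) := by
  rw [isAlgebraic_iff_isIntegral] at hβ ⊢
  rw [aeval_eq_sum_range]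
  refine IsIntegral.sum _ fun i _ => ?_
  rw [zsmul_eq_mul]
  refine IsIntegral.mul ?_ (hβ.pow i)
  have : ((q.coeff i : ℤ) : PadicAlgCl 2) = algebraMap ℚ (PadicAlgCl 2) (q.coeff i : ℚ) := by simp
  rw [this]
  exact isIntegral_algebraMap

/-- **the correction `γ_β = c_{k−1}(β)/c_k′(β)` is algebraic over `ℚ`** (it lies in `ℚ(β)`). -/
theorem isAlgebraic_corr (A B : ℤ[X]) (hB : B ≠ 0) {β : PadicAlgCl 2} (hβ : aeval β B = 0) :
    IsAlgebraic ℚ (aeval β A / aeval β (derivative B)) := by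
  have hb := isAlgebraic_of_aeval_eq_zero hB hβ
  rw [div_eq_mul_inv]
  exact (isAlgebraic_aeval_int A hb).mul (isAlgebraic_aeval_int (derivative B) hb).inv

/-- the integer vector of a rational point `r` on level `N`: `x(N, r) = (num r, den r, 2^{N!}·den r) ∈ ℤ³`. -/
def xvec (N : ℕ) (r : ℚ) : Fin 3 → ℤ := ![r.num, (r.den : ℤ), 2 ^ N ! * (r.den : ℤ)]

/-- `(N : ℕ) (r : ℚ) : xvec N r 0 = r.num`. -/
@[simp] theorem xvec_zero (N : ℕ) (r : ℚ) : xvec N r 0 = r.num := rfl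
/-- `(N : ℕ) (r : ℚ) : xvec N r 1 = (r.den : ℤ)`. -/
@[simp] theorem xvec_one (N : ℕ) (r : ℚ) : xvec N r 1 = (r.den : ℤ) := rfl
/-- `(N : ℕ) (r : ℚ) : xvec N r 2 = 2 ^ N ! * (r.den : ℤ)`. -/
@[simp] theorem xvec_two (N : ℕ) (r : ℚ) : xvec N r 2 = 2 ^ N ! * (r.den : ℤ) := rfl

/-- `x(N, r) ≠ 0` (its middle coordinate is `den r ≥ 1`). -/
theorem xvec_ne_zero (N : ℕ) (r : ℚ) : xvec N r ≠ 0 := by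
  intro h
  have h1 := congrFun h 1
  rw [xvec_one, Pi.zero_apply] at h1
  exact r.den_nz (by exact_mod_cast h1)

/-- the three REAL forms: the coordinate forms `X₀, X₁, X₂` (coefficients `0, 1`). -/
def Lform : Fin 3 → Fin 3 → ℝ := fun i => Pi.single i 1

/-- `(i : Fin 3) (y : Fin 3 → ℝ) : ∑ j, Lform i j * y j = y i` (the real forms are the coordinate forms). -/
theorem Lform_sum (i : Fin 3) (y : Fin 3 → ℝ) : ∑ j, Lform i j * y j = y i := by
  simp [Lform, Pi.single_apply]

/-- `LinearIndependent ℝ Lform` (the three real coordinate forms). -/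
theorem Lform_linearIndependent : LinearIndependent ℝ Lform := by
  classical
  have h : Lform = ⇑(Pi.basisFun ℝ (Fin 3)) := by
    funext i; simp [Lform, Pi.basisFun_apply]
  rw [h]
  exact (Pi.basisFun ℝ (Fin 3)).linearIndependent

/-- `(i j : Fin 3) : IsAlgebraic ℚ (Lform i j)` (coefficients `0` / `1`). -/
theorem Lform_isAlgebraic (i j : Fin 3) : IsAlgebraic ℚ (Lform i j) := by
  unfold Lform
  rw [Pi.single_apply]
  split_ifs
  · exact isAlgebraic_one
  · exact isAlgebraic_zero

/-- the three 2-ADIC forms at a simple root `β` with correction `γ`: `X₀ − β·X₁ + γ·X₂`, `X₁`, `X₂`. -/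
def Mform (β γ : PadicAlgCl 2) : Fin 3 → Fin 3 → PadicAlgCl 2 := ![![1, -β, γ], ![0, 1, 0], ![0, 0, 1]]

/-- `(β γ : PadicAlgCl 2) (y : Fin 3 → PadicAlgCl 2) : ∑ j, Mform β γ 0 j * y j = y 0 - β * y 1 + γ * y 2`. -/
theorem Mform_sum_zero (β γ : PadicAlgCl 2) (y : Fin 3 → PadicAlgCl 2) :
    ∑ j, Mform β γ 0 j * y j = y 0 - β * y 1 + γ * y 2 := by
  simp [Mform, Fin.sum_univ_three]; ring

/-- `(β γ : PadicAlgCl 2) (y : Fin 3 → PadicAlgCl 2) : ∑ j, Mform β γ 1 j * y j = y 1`. -/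
theorem Mform_sum_one (β γ : PadicAlgCl 2) (y : Fin 3 → PadicAlgCl 2) : ∑ j, Mform β γ 1 j * y j = y 1 := by
  simp [Mform, Fin.sum_univ_three]

/-- `(β γ : PadicAlgCl 2) (y : Fin 3 → PadicAlgCl 2) : ∑ j, Mform β γ 2 j * y j = y 2`. -/
theorem Mform_sum_two (β γ : PadicAlgCl 2) (y : Fin 3 → PadicAlgCl 2) : ∑ j, Mform β γ 2 j * y j = y 2 := by
  simp [Mform, Fin.sum_univ_three]

/-- the 2-adic forms are LINEARLY INDEPENDENT (unit upper-triangular). -/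
theorem Mform_linearIndependent (β γ : PadicAlgCl 2) : LinearIndependent (PadicAlgCl 2) (Mform β γ) := by
  rw [Fintype.linearIndependent_iff]
  intro g hg
  have h0 := congrFun hg 0
  have h1 := congrFun hg 1
  have h2 := congrFun hg 2
  simp [Fin.sum_univ_three, Mform] at h0 h1 h2
  intro i
  fin_cases i
  · exact h0
  · simpa [h0] using h1
  · simpa [h0] using h2

/-- the 2-adic forms have ALGEBRAIC coefficients when `β, γ` are algebraic. -/
theorem Mform_isAlgebraic {β γ : PadicAlgCl 2} (hβ : IsAlgebraic ℚ β) (hγ : IsAlgebraic ℚ γ) (i j : Fin 3) :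
    IsAlgebraic ℚ (Mform β γ i j) := by
  fin_cases i <;> fin_cases j <;>
    simp [Mform, isAlgebraic_one, isAlgebraic_zero, hβ.neg, hγ]

/-- the real side: `∏ |L_i(x)| = |num r|·den r·(2^{N!} den r)`. -/
theorem Lform_prod (N : ℕ) (r : ℚ) :
    ∏ i, |∑ j, Lform i j * ((xvec N r j : ℤ) : ℝ)| = |(r.num : ℝ)| * (r.den : ℝ) * (2 ^ N ! * (r.den : ℝ)) := by
  rw [Fin.prod_univ_three, Lform_sum, Lform_sum, Lform_sum, xvec_zero, xvec_one, xvec_two]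
  push_cast
  rw [abs_of_nonneg (by positivity : (0 : ℝ) ≤ (r.den : ℝ)),
    abs_of_nonneg (by positivity : (0 : ℝ) ≤ 2 ^ N ! * (r.den : ℝ))]

/-- the 2-adic side: `∏ ‖M_i(x)‖₂ = ‖den·((r − β) + 2^{N!}γ)‖₂ · ‖den‖₂ · ‖2^{N!} den‖₂`. -/
theorem Mform_prod (β γ : PadicAlgCl 2) (N : ℕ) (r : ℚ) :
    ∏ i, ‖∑ j, Mform β γ i j * ((xvec N r j : ℤ) : PadicAlgCl 2)‖ =
      ‖(r.den : PadicAlgCl 2) * (((r : PadicAlgCl 2) - β) + 2 ^ N ! * γ)‖ * ‖(r.den : PadicAlgCl 2)‖ *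
        ‖(2 : PadicAlgCl 2) ^ N ! * (r.den : PadicAlgCl 2)‖ := by
  rw [Fin.prod_univ_three, Mform_sum_zero, Mform_sum_one, Mform_sum_two, xvec_zero, xvec_one, xvec_two]
  push_cast
  have hnum : ((r.num : ℤ) : PadicAlgCl 2) = (r : PadicAlgCl 2) * (r.den : PadicAlgCl 2) := by
    have h := Rat.mul_den_eq_num r
    have h' : ((r * (r.den : ℚ) : ℚ) : PadicAlgCl 2) = ((r.num : ℚ) : PadicAlgCl 2) := by rw [h]
    push_cast at h'
    exact h'.symm
  rw [hnum]
  congr 2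
  ring_nf

/-- the rational relation a subspace imposes: `Σ f_j x_j = f₀·num r + f₁·den r + f₂·2^{N!}·den r`. -/
theorem xvec_relation (f : Fin 3 → ℚ) (N : ℕ) (r : ℚ) :
    ∑ j, f j * ((xvec N r j : ℤ) : ℚ) = f 0 * r.num + f 1 * r.den + f 2 * (2 ^ N ! * r.den) := by
  rw [Fin.sum_univ_three, xvec_zero, xvec_one, xvec_two]
  push_cast
  ring

/-- the size of `x(N, r)`: `‖x‖_sup ≤ 3·max(1, C)·2^{N!}·den r` in the window `|r| ≤ C`. -/
theorem xvec_sup_le (N : ℕ) (r : ℚ) (C : ℝ) (hr : |(r : ℝ)| ≤ C) :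
    ((Finset.univ.sup fun j => (xvec N r j).natAbs : ℕ) : ℝ) ≤ 3 * max 1 C * 2 ^ N ! * (r.den : ℝ) := by
  have hd1 : (1 : ℝ) ≤ r.den := by exact_mod_cast Nat.succ_le_of_lt r.den_pos
  have hC1 : 1 ≤ max 1 C := le_max_left _ _
  have h2N : (1 : ℝ) ≤ 2 ^ N ! := one_le_pow₀ (by norm_num)
  have hnumR : |(r.num : ℝ)| = |(r : ℝ)| * r.den := by
    have h := Rat.mul_den_eq_num r
    have h' : ((r * (r.den : ℚ) : ℚ) : ℝ) = ((r.num : ℚ) : ℝ) := by rw [h]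
    push_cast at h'
    rw [← h', abs_mul, abs_of_nonneg (by positivity : (0 : ℝ) ≤ (r.den : ℝ))]
  have hbase : (0 : ℝ) ≤ max 1 C * 2 ^ N ! * (r.den : ℝ) := by positivity
  -- each coordinate is at most `max(1,C)·2^{N!}·den`
  have h0 : ((xvec N r 0).natAbs : ℝ) ≤ max 1 C * 2 ^ N ! * (r.den : ℝ) := by
    rw [xvec_zero, Nat.cast_natAbs, Int.cast_abs, hnumR]
    calc |(r : ℝ)| * r.den ≤ max 1 C * 1 * r.den := by
          rw [mul_one]; gcongr; exact hr.trans (le_max_right _ _)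
      _ ≤ max 1 C * 2 ^ N ! * r.den := by gcongr
  have h1 : ((xvec N r 1).natAbs : ℝ) ≤ max 1 C * 2 ^ N ! * (r.den : ℝ) := by
    rw [xvec_one, Int.natAbs_natCast]
    calc (r.den : ℝ) = 1 * 1 * r.den := by ring
      _ ≤ max 1 C * 2 ^ N ! * r.den := by gcongr
  have h2 : ((xvec N r 2).natAbs : ℝ) ≤ max 1 C * 2 ^ N ! * (r.den : ℝ) := by
    rw [xvec_two, Nat.cast_natAbs, Int.cast_abs]
    push_cast
    rw [abs_of_nonneg (by positivity : (0 : ℝ) ≤ 2 ^ N ! * (r.den : ℝ))]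
    calc (2 : ℝ) ^ N ! * r.den = 1 * 2 ^ N ! * r.den := by ring
      _ ≤ max 1 C * 2 ^ N ! * r.den := by gcongr
  have hsum : (Finset.univ.sup fun j => (xvec N r j).natAbs : ℕ) ≤
      (xvec N r 0).natAbs + (xvec N r 1).natAbs + (xvec N r 2).natAbs := by
    refine Finset.sup_le fun j _ => ?_
    fin_cases j
    · exact (Nat.le_add_right _ _).trans (Nat.le_add_right _ _)
    · exact (Nat.le_add_left _ _).trans (Nat.le_add_right _ _)
    · exact Nat.le_add_left _ _
  calc ((Finset.univ.sup fun j => (xvec N r j).natAbs : ℕ) : ℝ)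
      ≤ ((xvec N r 0).natAbs : ℝ) + ((xvec N r 1).natAbs : ℝ) + ((xvec N r 2).natAbs : ℝ) := by
        exact_mod_cast hsum
    _ ≤ max 1 C * 2 ^ N ! * (r.den : ℝ) + max 1 C * 2 ^ N ! * (r.den : ℝ) + max 1 C * 2 ^ N ! * (r.den : ℝ) :=
        add_le_add (add_le_add h0 h1) h2
    _ = 3 * max 1 C * 2 ^ N ! * (r.den : ℝ) := by ring

/-! ### §5  The exponent inequality: `ε = 1/8` and `N₀ = N₀(C, P)` -/

/-- `(M+1)! − M! = M·M!`. -/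
private theorem factorial_succ_sub (M : ℕ) : (M + 1)! - M ! = M * M ! := by
  rw [Nat.factorial_succ, Nat.succ_mul]; omega

/-- the exponent comparison behind `ε = 1/8`: for `M ≥ 10` (`N = M + 1 ≥ 11`)
`(M+1)² + 25(M+2)(M+1) + 2(M+1)² < (16M + 8)(2M + 2)`. -/
private theorem exp_ineq {M : ℕ} (hM : 10 ≤ M) :
    (M + 1) * (M + 1) + 25 * ((M + 2) * (M + 1)) + (M + 1) * (2 * (M + 1)) < (8 * (M + 1) + 8 * M) * (2 * (M + 1)) := by
  nlinarith [hM]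

set_option maxHeartbeats 800000 in
/-- **THE EXPONENT INEQUALITY (`ε = 1/8`).**  For real `A, C₁, C` there is `N₂ = N₂(A, C₁, C)` such that for
`N ≥ N₂` and every `d ≥ 1` FAILING the `m₀ = 2` clause (`d^{2N} ≤ C·2^{(N+1)!}`):
`(A·d³·2^{−N!}·2^{−(N!−(N−1)!)})^8 · (C₁·2^{N!}·d) < 1` — i.e. the double product of §6 is `< ‖x‖_sup^{−1/8}`.
(Numerology: `d ≤ C^{1/2N}·2^{(N+1)!/2N}`, so in base `2^{(N−1)!}` the left side is `≤ 2^{(N−1)!·(28N² + 25N − 32N² + 16N)/2N} → 0`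
once `4N > 41`.) -/
theorem subspace_arith (A C₁ C : ℝ) :
    ∃ N₂ : ℕ, ∀ N, N₂ ≤ N → ∀ d : ℕ, 1 ≤ d → (d : ℝ) ^ (2 * N) ≤ C * 2 ^ (N + 1)! →
      (A * (d : ℝ) ^ 3 * ((1 / 2 : ℝ) ^ N ! * (1 / 2 : ℝ) ^ (Nat.factorial N - Nat.factorial (N - 1)))) ^ 8 *
        (C₁ * 2 ^ N ! * d) < 1 := by
  set G : ℝ := max 1 (A ^ 16 * C₁ ^ 2) * max 1 (C ^ 25) with hGdef
  have hGa : max 1 (A ^ 16 * C₁ ^ 2) ≤ G := le_mul_of_one_le_right (by positivity) (le_max_left _ _)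
  have hGc : max 1 (C ^ 25) ≤ G := le_mul_of_one_le_left (by positivity) (le_max_left _ _)
  have hG0 : 0 ≤ G := by positivity
  obtain ⟨N₂, hN₂⟩ := eventually_pow_le' G 0
  refine ⟨max N₂ 11, fun N hN d hd hcl => ?_⟩
  have hNN₂ : N₂ ≤ N := le_trans (le_max_left _ _) hN
  have hN11 : 11 ≤ N := le_trans (le_max_right _ _) hN
  obtain ⟨M, rfl⟩ : ∃ M, N = M + 1 := ⟨N - 1, by omega⟩
  have hM : 10 ≤ M := by omega
  have hG := hN₂ (M + 1) hNN₂
  rw [Nat.sub_zero] at hG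
  set W : ℝ := (2 : ℝ) ^ M ! with hW
  have hW1 : 1 < W := one_lt_pow₀ (by norm_num) (Nat.factorial_pos M).ne'
  have hW0 : 0 < W := by positivity
  have hdR : (1 : ℝ) ≤ d := by exact_mod_cast hd
  have hd0 : (0 : ℝ) ≤ d := by positivity
  -- every power of `2` as a power of `W = 2^{M!}`
  have e1 : (2 : ℝ) ^ (M + 1)! = W ^ (M + 1) := by
    rw [hW, ← pow_mul, Nat.factorial_succ, mul_comm]
  have e2 : (2 : ℝ) ^ (M + 1 + 1)! = W ^ ((M + 2) * (M + 1)) := by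
    rw [hW, ← pow_mul, Nat.factorial_succ, Nat.factorial_succ]; ring_nf
  have e3 : Nat.factorial (M + 1) - Nat.factorial (M + 1 - 1) = M * M ! := by
    rw [Nat.add_sub_cancel]; exact factorial_succ_sub M
  have e4 : (2 : ℝ) ^ ((M + 1) * (M + 1)!) = W ^ ((M + 1) * (M + 1)) := by
    rw [hW, ← pow_mul, Nat.factorial_succ]; ring_nf
  have e5 : (1 / 2 : ℝ) ^ (M + 1)! = (W ^ (M + 1))⁻¹ := by rw [one_div, inv_pow, e1]
  have e6 : (1 / 2 : ℝ) ^ (M * M !) = (W ^ M)⁻¹ := by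
    rw [one_div, inv_pow, hW, ← pow_mul, mul_comm]
  rw [e3, e5, e6, e1]
  rw [e2] at hcl
  rw [e4] at hG
  -- `C > 0` (the clause fails for some `d ≥ 1`)
  have hC : 0 < C := by
    have h1 : (1 : ℝ) ≤ (d : ℝ) ^ (2 * (M + 1)) := one_le_pow₀ hdR
    have h2 : 0 < C * W ^ ((M + 2) * (M + 1)) := lt_of_lt_of_le one_pos (h1.trans hcl)
    exact pos_of_mul_pos_left h2 (by positivity)
  by_contra h
  push Not at h
  have hpos : 0 < (W ^ (M + 1)) ^ 8 * (W ^ M) ^ 8 := by positivity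
  -- clear denominators: `W^{8(M+1)+8M} ≤ A^8·C₁·d^25·W^{M+1}`
  have key : (W ^ (M + 1)) ^ 8 * (W ^ M) ^ 8 ≤ A ^ 8 * C₁ * (d : ℝ) ^ 25 * W ^ (M + 1) := by
    have h1 := mul_le_mul_of_nonneg_left h hpos.le
    rw [mul_one] at h1
    refine h1.trans (le_of_eq ?_)
    field_simp
  -- raise to the power `2N = 2(M+1)` and insert the failed clause and `G^{M+2} ≤ W^{(M+1)²}`
  have hkey2 := pow_le_pow_left₀ hpos.le key (2 * (M + 1))
  have hAC : A ^ 16 * C₁ ^ 2 ≤ G := (le_max_right _ _).trans hGa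
  have hCG : C ^ 25 ≤ G := (le_max_right _ _).trans hGc
  have chain : W ^ ((8 * (M + 1) + 8 * M) * (2 * (M + 1))) ≤
      W ^ ((M + 1) * (M + 1) + 25 * ((M + 2) * (M + 1)) + (M + 1) * (2 * (M + 1))) := by
    calc W ^ ((8 * (M + 1) + 8 * M) * (2 * (M + 1)))
        = ((W ^ (M + 1)) ^ 8 * (W ^ M) ^ 8) ^ (2 * (M + 1)) := by ring
      _ ≤ (A ^ 8 * C₁ * (d : ℝ) ^ 25 * W ^ (M + 1)) ^ (2 * (M + 1)) := hkey2
      _ = (A ^ 16 * C₁ ^ 2) ^ (M + 1) * ((d : ℝ) ^ (2 * (M + 1))) ^ 25 * (W ^ (M + 1)) ^ (2 * (M + 1)) := by ring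
      _ ≤ G ^ (M + 1) * (C * W ^ ((M + 2) * (M + 1))) ^ 25 * (W ^ (M + 1)) ^ (2 * (M + 1)) := by
          gcongr
      _ = (G ^ (M + 1) * C ^ 25) * ((W ^ ((M + 2) * (M + 1))) ^ 25 * (W ^ (M + 1)) ^ (2 * (M + 1))) := by ring
      _ ≤ (G ^ (M + 1) * G) * ((W ^ ((M + 2) * (M + 1))) ^ 25 * (W ^ (M + 1)) ^ (2 * (M + 1))) := by
          gcongr
      _ = G ^ (M + 1 + 1) * ((W ^ ((M + 2) * (M + 1))) ^ 25 * (W ^ (M + 1)) ^ (2 * (M + 1))) := by ring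
      _ ≤ W ^ ((M + 1) * (M + 1)) * ((W ^ ((M + 2) * (M + 1))) ^ 25 * (W ^ (M + 1)) ^ (2 * (M + 1))) := by
          gcongr
      _ = W ^ ((M + 1) * (M + 1) + 25 * ((M + 2) * (M + 1)) + (M + 1) * (2 * (M + 1))) := by ring
  have hlt : W ^ ((M + 1) * (M + 1) + 25 * ((M + 2) * (M + 1)) + (M + 1) * (2 * (M + 1))) <
      W ^ ((8 * (M + 1) + 8 * M) * (2 * (M + 1))) := pow_lt_pow_right₀ hW1 (exp_ineq hM)
  exact absurd (chain.trans_lt hlt) (lt_irrefl _)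

end Summit.Schanuel.Schanuel.Theorems.RootDecomp1KSubspaceBranch

end
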